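import Mathlib
import Summits.ValiantsHypothesis.ValiantsHypothesis.Theses.ValuativeGCT
import Summits.ValiantsHypothesis.ValiantsHypothesis.Theses.GCTMult
import Summits.ValiantsHypothesis.ValiantsHypothesis.Theorems.ValuativeGCTValuativeFlipJetRankNullity
import Summits.ValiantsHypothesis.ValiantsHypothesis.Theorems.ValuativeGCTValuativeFlipSymBlowupMem
import Summits.ValiantsHypothesis.ValiantsHypothesis.Theorems.CutBites.Negative.NoCutInOddDegree
import Literature.NumberTheory.DiophantineGeometry.DetStabilizerKronecker
import Literature.NumberTheory.DiophantineGeometry.SchurWeylPlethysmRenameProofs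
import Literature.Computability.AlgebraicComplexity.OrbitClosureWeights
import Summits.ValiantsHypothesis.ValiantsHypothesis.Theorems.ValuativeGCTValuativeFlipStabInvLeExplicit
import Summits.ValiantsHypothesis.ValiantsHypothesis.Theorems.ValuativeGCTValuativeFlipSliceBound
import Summits.ValiantsHypothesis.ValiantsHypothesis.Theorems.ValuativeGCTValuativeFlipTangentRank
import Summits.ValiantsHypothesis.ValiantsHypothesis.Theorems.ValuativeGCTValuativeFlipHilbertLowerBound
import Summits.ValiantsHypothesis.ValiantsHypothesis.Theorems.ValuativeGCTValuativeFlipMultiplicityCount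
import Summits.ValiantsHypothesis.ValiantsHypothesis.Theorems.ValuativeGCTValuativeFlipGrowthGap
import Summits.ValiantsHypothesis.ValiantsHypothesis.Theorems.ValuativeGCTValuativeFlipBottomBridge
import Summits.ValiantsHypothesis.ValiantsHypothesis.Theorems.ValuativeGCTValuativeFlipKroneckerCensus

/-!
# Line `skew-restriction-rank` — skeleton for crux `ValuativeGCT.ValuativeFlip`
# (stmt-ValiantsHypothesis-12624, route-ValiantsHypothesis-ValuativeGCT; crux-plan, round 1)

**Idea (card `skew-restriction-rank`, ideator 1; triage r1: pass ×3, merge ≈ `boundary-covariant-census`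
= "one jet census of `T₀(λ)` along an Edmonds-gap locus").**  The crux compares the VALUATIVE
TRUNCATION `T_U(λ)` (threshold `t = δ(m-r)`) with the padded-permanent multiplicity.  The lever:
`T_U(λ)` sits inside the kernel of the sub-threshold JET MAP `J_{t-1}` (Taylor expansion along the gap
locus `L_U`, generic point `A_j = ∑_k x_{jk} u_k`, all `m²` entry directions as normal variables,
truncated at `Y`-order `≤ t-1`) restricted to the EXPLICIT untruncated space
`E(λ) = Hom_{mδ} ∩ (row-wise unimodular-sandwich and transpose invariants) ∩ (B-semi-invariants of weight λ*)`
— the symmetric-Kronecker space written without the abstract `End`-stabiliser — so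
`dim T_U(λ) ≤ dim E(λ) - rank(J_{t-1} | E(λ))` (stubs 1–2, rank–nullity), and the rank is FED FROM
BELOW by explicit certificates: highest-weight combinations of τ-symmetrised level-`δ` BLOW-UP
DETERMINANTS `det(∑_j T_j ⊗ X_j) + det(∑_j T_jᵀ ⊗ X_j)` (`X_j` = row `j` of `A` as an `m × m`
matrix; Domokos–Zubkov / Schofield–van den Bergh / Derksen–Weyman semi-invariants), which lie in
`E` by a one-line sandwich computation (stub 3).  The flip then reads, in census currency (stub 4,
the card's Transfer `C⁺` sharpened per triage to the full sub-threshold jets):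
`dim E(λ) - dim J_{t-1}(HWV_λ*(blow-up span)) < mult_{λ*} ℂ[Δ(X₀₀^{m-n} per_n)]` for some admissible
centre `(U, r)` — three explicitly computable quantities, no `K_m(λ)`, no Kronecker positivity, no
Frobenius.  `ValuativeFlip_of : ValuativeGCT.ValuativeFlip` composes the four stubs with sorry-free
lattice bookkeeping; `sorry` occurs only inside `stub_*`.  Stub statements mention only Mathlib,
`Literature.*` and the conventions of the route file (copied verbatim), so each can land as
`Theorems/ValuativeGCTValuativeFlip<Stub>.lean` with `--supports`.

**Why no Frobenius.**  Exactness `dim T_U(λ) = sk(λ) - rank(J_{t-1}|T₀(λ))` and `T₀ = E` need the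
hard half of Frobenius' determinant-preserver theorem (named fact
`frobenius_detPreserver_unimodular_sandwich`, being discharged by the CutBites line
`pencil-degree-frobenius`); the flip needs only the INEQUALITY, for which the easy half
(sandwiches and transpose stabilise `det_m`, stub 1) suffices: `T_U(t) ⊆ E ∩ ker J_{t-1}`.  Modulo
Frobenius + Domokos–Zubkov spanning + jet exactness, stub 4 is EQUIVALENT to the crux (no strength
lost); its gain is currency (every term is an explicit invariant-theoretic dimension, lower-boundable
by finite certificate families, monotone in the family).

**Disproof used** (cdisprove `Disproof.lean` for stmt-12624, five updates to 2026-08-15T23:09Z, read through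
its evidence notes — the file itself is gate evidence, not mounted in planner jails; nothing landed under
`Theorems/ValuativeFlip/Negative/`, so nothing to import):
`valuativeFlipWithoutRankBound_holds` (the rank bound is the only guard against triviality) — honoured:
stub 4 carries the rank bound AND `0 < δ(m-r)`, and stub 2 needs `s < t`; `truncT_of_le` / `truncT_bot_zero`
(r ≥ m, U = ⊥ give no cut) — for such centres the certificate term of stub 4 is `0` and the stub degenerates
honestly to the symmetric-Kronecker flip; §NullCone / transport (`truncT_eq_truncT₀_of_le_blockSpace`,
`truncT_eq_truncT₀_of_equiv_compression`: compression spaces, nc-rank ≤ r, give no cut) — the line card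
directs provers to Edmonds-gap centres (Λ_m for odd m, Λ_{m-1} ⊕ E_mm for even m, Koszul centres); §OneRow
(`no_oneRow_flip`, `orbitMultiplicity_paddedPer_oneRow_eq_one`) and §MOne (`not_flipBody_one`) — stub 4 keeps
the crux's window, `[NeZero m]`, `n ≤ m` and `∃ n₀` verbatim (the mutations `not_valuativeFlipWithoutLowerWindow`,
`not_valuativeFlipAllN` are not instances of any stub); F2 (`squareCase_of_valuativeFlip`: m = n free) —
not used (the census statement is uniform in m).  No stub restates the crux, the summit, or a refuted
statement (negatives index: UlrichPadded 5668, Elusive 0340, GrenetRigidity 3735/3738 — unrelated).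
-/

/-!
## STATUS (line lead prover-line-stmt-ValiantsHypothesis-12624-0, 2026-08-16, cycle 1)

* `stub_stabInv_le_explicit` — LANDED `Theorems/ValuativeGCTValuativeFlipStabInvLeExplicit.lean` (p73621); the
  statement below is the registered `:=`-free form (type ascriptions instead of `(R := ℂ)` / `(M := …)`; same term),
  and its 10-line proof is INLINED here (helpers `…'`) only because the farm had not yet built that module when this
  skeleton was re-registered; replace by the import once built.
* `explicit_le_stabInv` (lead helper, registered via stub-add) — LANDED
  `Theorems/ValuativeGCTValuativeFlipExplicitLeStabInv.lean` (p74341): the HARD half of Frobenius in the route's conventions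
  (`sandInv ⊓ trInv ≤ stabInv`, from `frobenius_detPreserver_unimodular_sandwich_holds`), so with stub 1 `stabInv = sandInv ⊓ trInv`
  and the route's untruncated space `T₀(λ)` IS this line's explicit space `E(λ)` (`dim E(λ) = sk(λ; δ^m)` exactly).
* `stub_jetRankNullity` — LANDED `Theorems/ValuativeGCTValuativeFlipJetRankNullity.lean` (p72388).
* `stub_symBlowup_mem` — LANDED `Theorems/ValuativeGCTValuativeFlipSymBlowupMem.lean` (p72978).
* `stub_jetCensusFlip` — RESHAPED (cycle 1) into `stub_bottomCensusFlip` (m = n: TRUE by the Hilbert-function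
  count, provable now but Lean-XL, decomposition in its docstring) and `stub_censusFlipAboveBottom` (n < m: OPEN,
  crux-sized, handed back as promote-stub).  The above-bottom stub is the crux in census currency (≡ crux modulo
  Frobenius — in tree, `frobenius_detPreserver_unimodular_sandwich_holds` —, Domokos–Zubkov spanning and jet
  exactness); lead census `Cruxes/ValuativeFlip/LeadCensus-c1.md` (drefute degree floor: witnesses need δ ≥ 5 at
  m = 4, δ ≥ 6 at m ≥ 5; no per-side engine in print; bottom m = n free but Lean-XL).
So this file is now, formally, `stub_bottomCensusFlip → stub_censusFlipAboveBottom → ValuativeGCT.ValuativeFlip`.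
-/

/-!
## STATUS (second line lead prover-line-stmt-ValiantsHypothesis-12624-1, 2026-08-16, cycle 1–2) — THE BOTTOM IS CLOSED

* Stubs 1–3 are imported from their landed `Theorems/` files.
* `stub_censusFlipAboveBottom` (n < m): OPEN, crux-sized, held by the lead (unchanged statement).
* `stub_bottomCensusFlip` (m = n; TRUE) is NO LONGER a stub: it is the sorry-free theorem
  `bottomCensusFlip_of_stubs` below, composed from SIX registered stubs, ALL LANDED in wave 1
  (p76637 SliceBound, p79806 TangentRank, p78710 HilbertLowerBound, p76419 MultiplicityCount, p76351 GrowthGap,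
  p77903 BottomBridge; composed file `Theorems/ValuativeGCTValuativeFlipBottomWindow.lean` with `valuativeFlip_bottom` =
  the crux body at `m := n`)
  - `stub_sliceBound`      (B1) `dim(Hom_D ∩ sandInv_n) ≤ (D+1)^(n⁴-2n²+2n)` — Krylov/companion slice for generic
                                 matrix pairs under `SL_n × SL_n`, density, restriction, monomial count;
  - `stub_tangentRank`     (B2) `per_n ≠ 0` and `dim span{x_a ∂_b per_n} ≥ n⁴ - n²` (private monomials, `n ≥ 3`);
  - `stub_hilbertLowerBound` (B3) `dim genericOrbitMap_f(ℂ[Sym^m]_δ) ≥ C(δ+N, N)` whenever the tangent span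
                                 `span{x_a ∂_b f}` has dimension `≥ N+1` (initial forms at `A = 1`; any form `f ≠ 0`);
  - `stub_multiplicityCount` (B4) finite-dimensional rational `GL`-modules: `dim V' < dim V ⇒ ∃χ, mult_{V'} χ < mult_V χ`;
  - `stub_growthGap`       (B5) `z+1 ≤ N ⇒ ∃δ, (nδ+1)^z < C(δ+N, N)`;
  - `stub_bottomBridge`    (B6) a dimension gap inside `ℂ[End W]` between `Hom_{nδ} ∩ sandInv ∩ trInv` and
                                 `genericOrbitMap_{per_n}(ℂ[Sym^n]_δ)` yields a crux-weight witness `λ ⊢ nδ`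
                                 (left-translation representation, `hwToPoly`, partition form + degree pinning),
                                 taking the counting lemma (B4) as a hypothesis.
  Composition: `z = n⁴-2n²+2n`, `N = n⁴-n²-1`, `z+1 ≤ N ⇔ n ≥ 3`; B5 gives `δ`; B1+B2+B3 give the gap; B6∘B4 gives `λ`.
So this file is now formally `stub_censusFlipAboveBottom → ValuativeGCT.ValuativeFlip` (the only `sorry` left is that stub).
Third lead (2026-08-16, prover-line-stmt-ValiantsHypothesis-12624-2): H-section added below (`## Logical position of the crux`); its one
registered stub H2 is landed, so the file again has exactly ONE `sorry` (`stub_censusFlipAboveBottom`), and the line is declared DEAD there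
(`Lines/skew-restriction-rank-dead.md`): the residual stub is the crux above the bottom (H1) and needs a per-side multiplicity lower bound.
-/

namespace Summit.ValiantsHypothesis.ValiantsHypothesis.Cruxes.ValuativeFlip.SkewRestrictionRank

open MvPolynomial
open scoped BigOperators Matrix Kronecker
open Literature.NumberTheory.DiophantineGeometry
open Literature.Computability.AlgebraicComplexity

set_option linter.dupNamespace false

noncomputable section
/-! ## The stubs -/

/-! ### Stubs 1–3 (LANDED; imported) -/

/-- **Stub 1 — the easy half of Frobenius in the route's conventions: abstract `Stab_End(det_m)`-invariants
are explicit invariants.**  A function on `End(ℂ^{m×m})` (variables `X (j, i)`, row slot `j`, matrix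
position `i = toLex (c, d)`) that is invariant under `A ↦ A·M` for EVERY `M` with `linSubst M det_m = det_m`
(the crux's third factor, verbatim) is in particular invariant under the row-wise unimodular sandwiches
`X_j ↦ P X_j Q` (`det P = det Q = 1`) and under the row-wise transpose `X_j ↦ X_jᵀ`.
Why true: each of these substitutions IS `φ_M` for an admissible `M`: the sandwich is `φ_M` for
`M l i = P (ofLex i).1 (ofLex l).1 * Q (ofLex l).2 (ofLex i).2`, the `toLex`-reindexing of `Pᵀ ⊗ₖ Q`, and
`linSubst (Pᵀ ⊗ₖ Q) det = det Pᵀ · det Q · det = det` is the tree's `linSubst_kronecker_detPoly`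
(DetStabilizerKronecker.lean) transported along `detFormLex = rename toLex detPoly`; the transpose is
`φ_{M_τ}` with `M_τ l i = [l = swap i]`, and `linSubst M_τ det = det Xᵀ = det X` (`Matrix.det_transpose`,
`AlgHom.map_det`).  Then `iInf_le` twice.  Size S–M (~150 lines: the `rename toLex` transport of `linSubst`
and the `Finset.sum` bookkeeping identifying `φ_M` with the displayed substitution).
[BLMW 2011 §5.2; Frobenius 1897; tree `linSubst_kronecker_detPoly`, `kronFinMat`] -/
theorem stub_stabInv_le_explicit (m : ℕ) :
    (⨅ (M : Matrix (MatIdx m) (MatIdx m) ℂ)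
        (_ : linSubst (MatIdx m) ℂ M (detFormLex ℂ m) = detFormLex ℂ m),
        LinearMap.ker ((MvPolynomial.aeval fun p : MatIdx m × MatIdx m =>
            ∑ l : MatIdx m, M l p.2 •
              (MvPolynomial.X (p.1, l) : MvPolynomial (MatIdx m × MatIdx m) ℂ)).toLinearMap -
          (LinearMap.id : MvPolynomial (MatIdx m × MatIdx m) ℂ →ₗ[ℂ] MvPolynomial (MatIdx m × MatIdx m) ℂ)))
      ≤ (⨅ (P : Matrix (Fin m) (Fin m) ℂ) (Q : Matrix (Fin m) (Fin m) ℂ) (_ : P.det = 1)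
            (_ : Q.det = 1),
          LinearMap.ker ((MvPolynomial.aeval fun p : MatIdx m × MatIdx m =>
              ∑ l : MatIdx m, (P (ofLex p.2).1 (ofLex l).1 * Q (ofLex l).2 (ofLex p.2).2) •
                (MvPolynomial.X (p.1, l) : MvPolynomial (MatIdx m × MatIdx m) ℂ)).toLinearMap -
            (LinearMap.id : MvPolynomial (MatIdx m × MatIdx m) ℂ →ₗ[ℂ] MvPolynomial (MatIdx m × MatIdx m) ℂ))) ⊓
        LinearMap.ker ((MvPolynomial.aeval fun p : MatIdx m × MatIdx m =>
            (MvPolynomial.X (p.1, toLex ((ofLex p.2).2, (ofLex p.2).1)) :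
              MvPolynomial (MatIdx m × MatIdx m) ℂ)).toLinearMap -
          (LinearMap.id : MvPolynomial (MatIdx m × MatIdx m) ℂ →ₗ[ℂ] MvPolynomial (MatIdx m × MatIdx m) ℂ)) := by
  -- LANDED: Theorems/ValuativeGCTValuativeFlipStabInvLeExplicit.lean (p73621)
  exact _root_.Summit.ValiantsHypothesis.ValiantsHypothesis.Theorems.ValuativeFlip.stub_stabInv_le_explicit m

/-- **Stub 2 — the hinge (card's `RestrictionRankBound`, jet form per triage r1-1/2/3): powers of the
ideal of the gap locus die under sub-threshold jets; rank–nullity.**  For a spanning family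
`u : Fin d → U` of the row space `U`, the JET MAP of order `s` substitutes the generic point of
`L_U = {A | every row ∈ U}` displaced by a full matrix of normal variables,
`X (j, i) ↦ ∑_k u_k(i) · x_(j,k) + Y_(j,i)`, and keeps the components of `Y`-degree `≤ s`
(`weightedHomogeneousComponent` for the weight `x ↦ 0, Y ↦ 1`).  For every subspace `W` of forms of
degree `D` and every `s < t`:  `finrank (W ∩ P_U^t) + finrank J_s(W) ≤ finrank W`, `P_U` the vanishing
ideal of `L_U`.
Why true: (i) `G ∈ P_U` ⇒ the `Y`-free component of `G(u·x + Y)` is `G(u·x)`, a polynomial vanishing at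
every point (its value at `(x, y)` is `G` at a matrix with rows in `span u = U`), hence `0`
(`MvPolynomial.funext`, `ℂ` infinite); (ii) `aeval` is multiplicative and `Y`-weights add, so a product of
`t` elements of `P_U` (times anything) has no component of `Y`-degree `< t`: `P_U^t ≤ ker J_s`
(`Submodule.pow_induction_on_left'` / `Ideal.mul_induction_on`, `IsWeightedHomogeneous.mul`,
`weightedHomogeneousComponent_eq_zero`); (iii) `W ∩ P_U^t ≤ W ∩ ker J_s` and
`finrank (W ∩ ker J_s) + finrank J_s(W) = finrank W` (`LinearMap.finrank_range_add_finrank_ker` for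
`J_s ∘ W.subtype`; `W` is finite-dimensional inside `Hom_D`, `MvPolynomial.homogeneousSubmodule_fg`).
Not vacuous and correctly guarded: `d = 0` (`U = ⊥`, `L_U = {0}`) makes `J_s = ` "components of degree
`≤ s`", which kills `Hom_D` only for `s < D` — consistent, since then `P_⊥^t ∩ Hom_D = Hom_D` iff `t ≤ D`;
`s < t` is essential (for `s ≥ t` the jets see `P^t`).  Size M (~300 lines, `MvPolynomial` weighted-component
API).  [card First lemma; triage r1-1 F5, r1-2 §2, r1-3; Mathlib `MvPolynomial.weightedHomogeneousComponent`,
`MvPolynomial.vanishingIdeal`, `MvPolynomial.funext`] -/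
theorem stub_jetRankNullity (m d : ℕ) (u : Fin d → MatIdx m → ℂ) (U : Submodule ℂ (MatIdx m → ℂ))
    (hU : Submodule.span ℂ (Set.range u) = U) (D t s : ℕ) (hst : s < t)
    (W : Submodule ℂ (MvPolynomial (MatIdx m × MatIdx m) ℂ))
    (hW : W ≤ MvPolynomial.homogeneousSubmodule (MatIdx m × MatIdx m) ℂ D) :
    let J : MvPolynomial (MatIdx m × MatIdx m) ℂ →ₗ[ℂ]
        MvPolynomial ((MatIdx m × Fin d) ⊕ (MatIdx m × MatIdx m)) ℂ :=
      (∑ e ∈ Finset.range (s + 1),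
          MvPolynomial.weightedHomogeneousComponent
            (Sum.elim (fun _ => 0) (fun _ => 1) : (MatIdx m × Fin d) ⊕ (MatIdx m × MatIdx m) → ℕ) e) ∘ₗ
        (MvPolynomial.aeval (R := ℂ) fun p : MatIdx m × MatIdx m =>
            (∑ k : Fin d, u k p.2 • MvPolynomial.X (Sum.inl (p.1, k))) +
              MvPolynomial.X (Sum.inr p)).toLinearMap
    Module.finrank ℂ ↥(W ⊓ ((MvPolynomial.vanishingIdeal ℂ
        {p : MatIdx m × MatIdx m → ℂ | ∀ j : MatIdx m, (fun i => p (j, i)) ∈ U}) ^ t).restrictScalars ℂ) +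
      Module.finrank ℂ ↥(W.map J) ≤ Module.finrank ℂ ↥W :=
  -- LANDED: Theorems/ValuativeGCTValuativeFlipJetRankNullity.lean (p72388)
  _root_.Summit.ValiantsHypothesis.ValiantsHypothesis.Theorems.ValuativeFlip.stub_jetRankNullity
    m d u U hU D t s hst W hW

/-- **Stub 3 — feeding lemma: τ-symmetrised level-`δ` blow-up determinants are explicit invariants of
degree `mδ`.**  For `T : MatIdx m → Mat_δ(ℂ)` (one `δ × δ` block per row slot) put
`F_T(A) = det(∑_j T_j ⊗ X_j)` — the determinant of the `δm × δm` matrix of linear forms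
`((a₁,a₂),(b₁,b₂)) ↦ ∑_j T_j(a₁,b₁) · X (j, toLex (a₂, b₂))` — and `G_T = F_T + F_{Tᵀ}` (`Tᵀ` blockwise).
Then `G_T` is homogeneous of degree `m * δ`, invariant under every row-wise unimodular sandwich
`X_j ↦ P X_j Q`, and invariant under the row-wise transpose.
Why true: `∑_j T_j ⊗ (P X_j Q) = (1 ⊗ P)(∑_j T_j ⊗ X_j)(1 ⊗ Q)` (`Matrix.mul_kronecker_mul`) and
`det (1_δ ⊗ P) = (det P)^δ = 1` (`Matrix.det_kronecker`), so both summands are sandwich-invariant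
(`AlgHom.map_det` / `AlgHom.mapMatrix` to push `aeval` inside the determinant); `∑_j T_j ⊗ X_jᵀ =
(∑_j T_jᵀ ⊗ X_j)ᵀ`, so the transpose swaps `F_T` and `F_{Tᵀ}` (`Matrix.det_transpose`); homogeneity of a
determinant of linear forms in `card (Fin δ × Fin m) = δm = mδ` variables-worth of degree
(`Matrix.det_apply'` + `IsHomogeneous.prod`/`sum`, cf. tree `detPoly_isHomogeneous`).  These are the level-δ
Schofield–van den Bergh / Domokos–Zubkov / Derksen–Weyman semi-invariants of the `m²`-arrow Kronecker
quiver (which SPAN the `SL_m × SL_m`-invariants of degree `mδ` — not needed here, only membership is);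
level `1` (`δ = 1`, `T_j` scalars) gives `det` of a combination of rows, i.e. the closure functions; the
certificates of the line live at level `≥ 2` (triage: `rk₂(Λ_m) = 2m` for odd `m ≤ 13`, explicit
`LevelTwoSkewWitness` `det = −4` / `−1`).  Size M (~300 lines: Kronecker-product bookkeeping over the
polynomial ring, one homogeneity computation).  [doi:10.1007/bf01236060 Thm 1.1; arXiv:math/9907174;
arXiv:1512.03531; tree `linSubst_kronecker_detPoly` as template] -/
theorem stub_symBlowup_mem (m δ : ℕ) (T : MatIdx m → Matrix (Fin δ) (Fin δ) ℂ) :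
    let G : MvPolynomial (MatIdx m × MatIdx m) ℂ :=
      (Matrix.of fun a b : Fin δ × Fin m =>
          ∑ j : MatIdx m, T j a.1 b.1 • MvPolynomial.X (R := ℂ) (j, toLex (a.2, b.2))).det +
      (Matrix.of fun a b : Fin δ × Fin m =>
          ∑ j : MatIdx m, (T j)ᵀ a.1 b.1 • MvPolynomial.X (R := ℂ) (j, toLex (a.2, b.2))).det
    G.IsHomogeneous (m * δ) ∧
    (∀ P Q : Matrix (Fin m) (Fin m) ℂ, P.det = 1 → Q.det = 1 →
      MvPolynomial.aeval (R := ℂ) (fun p : MatIdx m × MatIdx m =>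
        ∑ l : MatIdx m, (P (ofLex p.2).1 (ofLex l).1 * Q (ofLex l).2 (ofLex p.2).2) •
          MvPolynomial.X (R := ℂ) (p.1, l)) G = G) ∧
    MvPolynomial.aeval (R := ℂ) (fun p : MatIdx m × MatIdx m =>
        MvPolynomial.X (R := ℂ) (p.1, toLex ((ofLex p.2).2, (ofLex p.2).1))) G = G :=
  -- LANDED: Theorems/ValuativeGCTValuativeFlipSymBlowupMem.lean (p72978)
  _root_.Summit.ValiantsHypothesis.ValiantsHypothesis.Theorems.ValuativeFlip.stub_symBlowup_mem m δ T
/-- **Stub 4b — THE CENSUS FLIP ABOVE THE BOTTOM (`n < m ≤ 2^((log₂ n + c)^c)`): the OPEN, crux-sized stub.**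
Verbatim the planner's `stub_jetCensusFlip` with `n ≤ m` sharpened to `n < m` (the bottom `m = n` is stub 4a):
for every `c` and all large `n`, for every `m` in the window ABOVE `n` there are an admissible centre `(U, r)`
(rank `≤ r` on `U`, `0 < δ(m-r)`; by Disproof §NullCone only Edmonds-gap centres carry a non-zero certificate),
a spanning family `u`, a degree `δ` and a shape `λ ⊢ mδ` (`≤ m²` parts) with
`dim E(λ) < mult_{λ*} ℂ[Δ(X₀₀^{m-n} per_n)] + dim J_{δ(m-r)-1}(HWV_{λ*} ∩ V_δ)`.  STATUS (lead census
`Cruxes/ValuativeFlip/LeadCensus-c1.md`): equivalent to the crux above the bottom modulo theorems in the tree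
(Frobenius `frobenius_detPreserver_unimodular_sandwich_holds`) and in print (Domokos–Zubkov spanning, jet
exactness); drefute degree floor: witnesses need `δ ≥ 5` at `m = 4` and `δ ≥ 6` at `m ≥ 5`
(`DrefuteNoLowDegreeFlip.lean`: no flip in an equation-free degree of `Det_m`), and `ℓ(λ) ≳ (log₂ n)^(c-1)` rows
at the top of the window (few-row shapes inherit `Per ⊆ Det`); no per-side engine in print gives
`mult_pp > K_m` anywhere.  This is the research content of the crux — multiplicity obstructions for the padded
permanent throughout the Mulmuley–Sohoni window — and is handed back as `promote-stub`.
[arXiv:1911.03990; arXiv:1512.03798 Thm 4; arXiv:1604.06431; KadishLandsberg2014; doi:10.1007/bf01236060;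
arXiv:math/0512651; arXiv:1003.4474; arXiv:0907.3351; arXiv:1606.06701 §4] -/
theorem stub_censusFlipAboveBottom :
    ∀ c : ℕ, ∃ n₀ : ℕ, ∀ n ≥ n₀, ∀ (m : ℕ) [NeZero m], n < m → m ≤ 2 ^ ((Nat.log 2 n + c) ^ c) →
      ∃ (U : Submodule ℂ (MatIdx m → ℂ)) (r d : ℕ) (u : Fin d → MatIdx m → ℂ) (δ : ℕ)
        (lam : Nat.Partition (m * δ)),
        (∀ v ∈ U, (Matrix.of fun a b : Fin m => v (toLex (a, b))).rank ≤ r) ∧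
        Submodule.span ℂ (Set.range u) = U ∧ lam.parts.card ≤ m * m ∧ 0 < δ * (m - r) ∧
        (let χ : Weight (MatIdx m) := (Weight.dualOfPartition (m * m) lam).toMatIdx
         let H : Submodule ℂ (MvPolynomial (MatIdx m × MatIdx m) ℂ) :=
           ⨅ (g : Matrix.GeneralLinearGroup (MatIdx m) ℂ) (_ : IsUpperTriangular g),
             LinearMap.ker ((MvPolynomial.aeval (R := ℂ) fun p : MatIdx m × MatIdx m =>
                 ∑ l : MatIdx m, ((g⁻¹ : Matrix.GeneralLinearGroup (MatIdx m) ℂ) :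
                   Matrix (MatIdx m) (MatIdx m) ℂ) p.1 l • MvPolynomial.X (l, p.2)).toLinearMap -
               weightChar χ g • LinearMap.id (R := ℂ) (M := MvPolynomial (MatIdx m × MatIdx m) ℂ))
         let E : Submodule ℂ (MvPolynomial (MatIdx m × MatIdx m) ℂ) :=
           MvPolynomial.homogeneousSubmodule (MatIdx m × MatIdx m) ℂ (m * δ) ⊓
             ((⨅ (P : Matrix (Fin m) (Fin m) ℂ) (Q : Matrix (Fin m) (Fin m) ℂ) (_ : P.det = 1)
                  (_ : Q.det = 1),
                 LinearMap.ker ((MvPolynomial.aeval (R := ℂ) fun p : MatIdx m × MatIdx m =>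
                     ∑ l : MatIdx m, (P (ofLex p.2).1 (ofLex l).1 * Q (ofLex l).2 (ofLex p.2).2) •
                       MvPolynomial.X (p.1, l)).toLinearMap -
                   LinearMap.id (R := ℂ) (M := MvPolynomial (MatIdx m × MatIdx m) ℂ))) ⊓
               LinearMap.ker ((MvPolynomial.aeval (R := ℂ) fun p : MatIdx m × MatIdx m =>
                   (MvPolynomial.X (p.1, toLex ((ofLex p.2).2, (ofLex p.2).1)) :
                     MvPolynomial (MatIdx m × MatIdx m) ℂ)).toLinearMap -
                 LinearMap.id (R := ℂ) (M := MvPolynomial (MatIdx m × MatIdx m) ℂ))) ⊓ H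
         let J : MvPolynomial (MatIdx m × MatIdx m) ℂ →ₗ[ℂ]
             MvPolynomial ((MatIdx m × Fin d) ⊕ (MatIdx m × MatIdx m)) ℂ :=
           (∑ e ∈ Finset.range (δ * (m - r) - 1 + 1),
               MvPolynomial.weightedHomogeneousComponent
                 (Sum.elim (fun _ => 0) (fun _ => 1) :
                   (MatIdx m × Fin d) ⊕ (MatIdx m × MatIdx m) → ℕ) e) ∘ₗ
             (MvPolynomial.aeval (R := ℂ) fun p : MatIdx m × MatIdx m =>
                 (∑ k : Fin d, u k p.2 • MvPolynomial.X (Sum.inl (p.1, k))) +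
                   MvPolynomial.X (Sum.inr p)).toLinearMap
         let V : Submodule ℂ (MvPolynomial (MatIdx m × MatIdx m) ℂ) :=
           Submodule.span ℂ (Set.range fun T : MatIdx m → Matrix (Fin δ) (Fin δ) ℂ =>
             (Matrix.of fun a b : Fin δ × Fin m =>
                 ∑ j : MatIdx m, T j a.1 b.1 • MvPolynomial.X (R := ℂ) (j, toLex (a.2, b.2))).det +
             (Matrix.of fun a b : Fin δ × Fin m =>
                 ∑ j : MatIdx m, (T j)ᵀ a.1 b.1 • MvPolynomial.X (R := ℂ) (j, toLex (a.2, b.2))).det)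
         Module.finrank ℂ ↥E <
           orbitMultiplicity ℂ (paddedPerFormLex ℂ n m) m χ + Module.finrank ℂ ↥((H ⊓ V).map J)) := by
  sorry


/-! ### The bottom of the window (`m = n`): six worker-sized stubs (second lead, cycle 1) -/

/-- **Stub B1 — slice bound for row-wise sandwich invariants.**  For `n ≥ 2` and every degree `D`,
the forms of degree `D` on `End(ℂ^{n×n}) = (Mat_n)^{n²}` (variables `X (j, i)`, row slot `j`, matrix
position `i = toLex (c, d)`) that are invariant under every row-wise unimodular sandwich `X_j ↦ P X_j Q`
(`det P = det Q = 1`; the crux's convention, verbatim the line's `sandInv`) form a space of dimension at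
most `(D+1)^(n⁴ - 2n² + 2n)`.
Why true: restriction to the linear slice `S = {A : A_{j₀} ∈ ℂ·1, A_{j₁} ∈ L, A_j free (j ≠ j₀, j₁)}`,
`L = {B : B a b = 0 unless a = b+1 or b = n-1}` (subdiagonal + last column, `dim L = 2n-1`), is INJECTIVE on
sandwich-invariant polynomials: for `A` in the Zariski-dense set `det A_{j₀} ≠ 0`, `det K ≠ 0`
(`K` = Krylov matrix `[e₀ | B e₀ | … | B^{n-1} e₀]` of `B = A_{j₁} · adj A_{j₀}`) there are `P, Q` with
`det P = det Q = 1` and `(P A_j Q)_j ∈ S` (take `Q = A_{j₀}⁻¹ P⁻¹ c`, `cⁿ = det A_{j₀}`, `P = α K(A_{j₁}A_{j₀}⁻¹)⁻¹`: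
`K⁻¹ B K` is a companion matrix, `P A_{j₀} Q = c·1`; rescale `(P, Q) ↦ (αP, α⁻¹Q)` to get both determinants `1`),
so an invariant `G` vanishing on `S` vanishes on that dense set, hence `G · det(A_{j₀}) · det K = 0`
(`MvPolynomial.funext`) and `G = 0` (domain; both factors are nonzero polynomials: test `A_{j₀} = 1`,
`A_{j₁}` = cyclic shift).  The restriction map is `aeval` of the linear coordinate projection onto `S`; it sends
`Hom_D` into degree-`D` forms in the `z = 1 + (2n-1) + (n²-2)n² = n⁴-2n²+2n` slice coordinates, whose dimension is
at most the number of monomials of degree `≤ D` in `z` variables `≤ (D+1)^z`.  No eigenvalues, no Jordan form.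
Size L (~500 lines).  [folklore: Krylov / rational canonical form of a cyclic matrix; Mathlib `Matrix.adjugate`,
`MvPolynomial.funext`, `IsAlgClosed.exists_pow_nat_eq`] -/
theorem stub_sliceBound (n : ℕ) (hn : 2 ≤ n) (D : ℕ) :
    Module.finrank ℂ ↥(MvPolynomial.homogeneousSubmodule (MatIdx n × MatIdx n) ℂ D ⊓
        (⨅ (P : Matrix (Fin n) (Fin n) ℂ) (Q : Matrix (Fin n) (Fin n) ℂ) (_ : P.det = 1) (_ : Q.det = 1),
          LinearMap.ker ((MvPolynomial.aeval fun p : MatIdx n × MatIdx n =>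
              ∑ l : MatIdx n, (P (ofLex p.2).1 (ofLex l).1 * Q (ofLex l).2 (ofLex p.2).2) •
                (MvPolynomial.X (p.1, l) : MvPolynomial (MatIdx n × MatIdx n) ℂ)).toLinearMap -
            (LinearMap.id : MvPolynomial (MatIdx n × MatIdx n) ℂ →ₗ[ℂ] MvPolynomial (MatIdx n × MatIdx n) ℂ)))) ≤
      (D + 1) ^ (n ^ 4 - 2 * n ^ 2 + 2 * n) :=
  -- LANDED: Theorems/ValuativeGCTValuativeFlipSliceBound.lean (p76637)
  _root_.Summit.ValiantsHypothesis.ValiantsHypothesis.Theorems.ValuativeFlip.stub_sliceBound n hn D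

/-- **Stub B2 — tangent rank of the permanent.**  For `n ≥ 3`, the padded permanent at the bottom of the
window (`paddedPerFormLex ℂ n n = per_n` in the lexicographic matrix variables, padding exponent `0`) is nonzero,
and the `n⁴` polynomials `x_a · ∂_b per_n` (the image of `gl_{n²}` acting on `per_n`) span a space of dimension
at least `n⁴ - n²`.
Why true: `per_n(1) = 1`.  For the rank, the sub-family `a ≠ b` (size `n⁴ - n²`) is linearly independent: write
`a = (i,j)`, `b = (k,l)`, so `x_a ∂_b per = x_{ij} · per(minor_{kl})`.  (S) `i ≠ k`, `j ≠ l`: the monomial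
`x_{ij}² · (a permutation monomial of the minor deleting rows i,k and columns j,l)` occurs with coefficient `1` and in
NO other member (a square forces `a = (i,j)` and `b` = the missing row/column).  (T₁) `i = k`, `j ≠ l`: monomials
have every row once, column `l` empty, column `j` doubled in rows `{i, r}`; such a monomial lies exactly in the two
members `(i,j),(i,l)` and `(r,j),(r,l)`, coefficient `1` each, so a relation forces `c_i + c_r = 0` for all `i ≠ r`,
hence `c = 0` once `n ≥ 3` (three indices, characteristic `0`).  (T₂) `j = l`, `i ≠ k`: symmetric.  The three types
have pairwise disjoint supports, so the whole family `a ≠ b` is independent; `finrank (span of all) ≥ n⁴ - n²`.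
(`n = 2` genuinely fails: `per₂ ≅ det₂`.)  Transport: `paddedPerFormLex ℂ n n = rename toLex (X₀₀^0 * rename _ (perPoly _))`;
`rename` along an injection is injective and commutes with `X a * pderiv b`.  Size M–L (~400 lines).
[folklore; Mathlib `Matrix.permanent`, `MvPolynomial.pderiv`, `MvPolynomial.rename_injective`] -/
theorem stub_tangentRank (n : ℕ) [NeZero n] (hn : 3 ≤ n) :
    paddedPerFormLex ℂ n n ≠ 0 ∧
      n ^ 4 - n ^ 2 ≤ Module.finrank ℂ ↥(Submodule.span ℂ (Set.range fun ab : MatIdx n × MatIdx n =>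
        MvPolynomial.X ab.1 * MvPolynomial.pderiv ab.2 (paddedPerFormLex ℂ n n))) :=
  -- LANDED: Theorems/ValuativeGCTValuativeFlipTangentRank.lean (p79806)
  _root_.Summit.ValiantsHypothesis.ValiantsHypothesis.Theorems.ValuativeFlip.stub_tangentRank n hn

/-- **Stub B3 — Hilbert-function lower bound for an orbit closure from the tangent rank (any form).**
For a nonzero form `f` of degree `m` in variables `σ` and the generic orbit map
`genericOrbitMap f m : ℂ[Sym^m] → ℂ[Mat_σ]`, `F ↦ (A ↦ F(A·f))` (whose kernel is `I(GL·f)`, so its image in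
degree `δ` IS `ℂ[Δ_m[f]]_δ`), if the tangent space `span{x_a ∂_b f : a, b}` has dimension `≥ N + 1` then
`dim genericOrbitMap(ℂ[Sym^m]_δ) ≥ C(δ+N, N)` for every `δ`.
Why true (initial forms at `A = 1`, no Jacobian criterion): let `c_e = genericOrbitMap (X_e)` (coefficient of
`x^e` in `(A·f)(x) = f(x_i ↦ ∑_j A_{ji} x_j)`), `τ` the translation automorphism `X_p ↦ X_p + [p.1 = p.2]` of
`ℂ[Mat_σ]`.  Then `τ c_e = coeff_e f + ℓ_e + (A-degree ≥ 2)` with `ℓ_e = ∑_{(j,i)} coeff_e(x_j ∂_i f) · X_{(j,i)}`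
(first-order expansion of `∏ (x_i + ∑_j A_{ji} x_j)^{e_i}`), so `dim span{ℓ_e} = rank [coeff_e(x_j ∂_i f)] =
dim span{x_a ∂_b f} ≥ N+1`.  Pick `e₀` with `κ₀ = coeff_{e₀} f ≠ 0` (`f ≠ 0` homogeneous of degree `m`), put
`u₀ = c_{e₀}`, `u_e = c_e - (κ_e/κ₀) c_{e₀}`: `τ u_e` has no constant term and linear part `ℓ'_e = ℓ_e - (κ_e/κ₀)ℓ_{e₀}`,
and `dim span{ℓ'_e} ≥ N`; choose `e_1, …, e_N` with `ℓ'_{e_i}` linearly independent.  The `C(δ+N, N)` products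
`u₀^{δ-|β|} ∏ u_{e_i}^{β_i}` (`β ∈ ℕ^N`, `|β| ≤ δ`) are images of degree-`δ` forms (products of `δ` linear forms in
the `X_e`) and are linearly independent: applying `τ`, the homogeneous component of degree `|β|` of the product is
`κ₀^{δ-|β|} ∏ ℓ'^{β}` and all lower components vanish, so in a relation the minimal `|β|` layer gives a relation
among monomials of one degree in linearly independent linear forms — impossible (they are algebraically
independent: evaluation `A ↦ (ℓ'_i(A))_i` is onto `ℂ^N`, then `MvPolynomial.funext`).
Size L (~500 lines: the first-order expansion of `linSubst (1 + A)`, `homogeneousComponent` of products,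
`exists_linearIndependent`, the count `#{β : |β| ≤ δ} = C(δ+N,N)` e.g. via `Sym (Fin (N+1)) δ` and
`Finset.card_sym`/`Nat.multichoose_eq`).  [folklore (tangent cone / initial forms); tree `genericOrbitMap`,
`eval_genericOrbitMap`, `linSubst_mul`; Mathlib `MvPolynomial.homogeneousComponent`, `MvPolynomial.pderiv`] -/
theorem stub_hilbertLowerBound (σ : Type) [Fintype σ] [LinearOrder σ]
    (f : MvPolynomial σ ℂ) (m : ℕ) (hf : f.IsHomogeneous m) (hf0 : f ≠ 0) (N δ : ℕ)
    (hN : N + 1 ≤ Module.finrank ℂ ↥(Submodule.span ℂ (Set.range fun ab : σ × σ =>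
        MvPolynomial.X ab.1 * MvPolynomial.pderiv ab.2 f))) :
    Nat.choose (δ + N) N ≤ Module.finrank ℂ ↥((MvPolynomial.homogeneousSubmodule (DegIdx σ m) ℂ δ).map
        (genericOrbitMap f m).toLinearMap) :=
  -- LANDED: Theorems/ValuativeGCTValuativeFlipHilbertLowerBound.lean (p78710)
  _root_.Summit.ValiantsHypothesis.ValiantsHypothesis.Theorems.ValuativeFlip.stub_hilbertLowerBound σ f m hf hf0 N δ hN

/-- **Stub B4 — the counting lemma for finite-dimensional rational `GL`-modules.**  Over `ℂ`, if two
finite-dimensional rational representations `V, V'` of `GL σ ℂ` have `dim V' < dim V`, then some weight `χ` has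
strictly smaller highest-weight multiplicity in `V'` than in `V` (`hwMultiplicity` = dimension of the
`B`-semi-invariants of weight `χ`, tree `GLHighestWeight`).
Why true: complete reducibility (`isSemisimpleRepresentation_of_isRationalRep_holds`) + theorem of the highest
weight.  Contrapositive by induction on `dim V`: if `mult_V χ ≤ mult_{V'} χ` for all `χ`, pick an irreducible
subrepresentation `W ≤ V` (minimal nonzero, `V ≠ 0`), its highest weight `χ₀`
(`exists_hasHighestWeight_of_finiteDimensional_holds`, rational by restriction `IsRationalRep.toRepresentation`);
`mult_{V'} χ₀ ≥ mult_V χ₀ ≥ 1` and `hwMultiplicity_eq_finrank_intertwiningMap_holds` give a nonzero — hence injective —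
intertwiner `W → V'`; with complements `V = W ⊕ C`, `V' = W' ⊕ C'` (`W' ≅ W` its image) multiplicities add over the
summands (`highestWeightSpace` of an internal direct sum of subrepresentations is the direct sum) and agree on
`W ≅ W'` (`hwMultiplicity_congr`), so `mult_C ≤ mult_{C'}` pointwise and induction embeds `C ↪ C'`, whence
`dim V ≤ dim V'`.  Size M–L (~400 lines).  [Goodman–Wallach Thm 4.2.12 / eq. (4.26); Fulton–Harris §15.5; tree
`GLHighestWeight*`, `GLPolynomialRepSemisimpleProofs`, `MultiplicityObstructionsProofs` (`exists_section_of_surjective`)] -/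
theorem stub_multiplicityCount (σ : Type) [Fintype σ] [LinearOrder σ]
    (V : Type) [AddCommGroup V] [Module ℂ V] [FiniteDimensional ℂ V]
    (V' : Type) [AddCommGroup V'] [Module ℂ V'] [FiniteDimensional ℂ V']
    (ρ : Representation ℂ (GL σ ℂ) V) (ρ' : Representation ℂ (GL σ ℂ) V')
    (hρ : IsRationalRep ρ) (hρ' : IsRationalRep ρ')
    (h : Module.finrank ℂ V' < Module.finrank ℂ V) :
    ∃ χ : Weight σ, hwMultiplicity ρ' χ < hwMultiplicity ρ χ :=
  -- LANDED: Theorems/ValuativeGCTValuativeFlipMultiplicityCount.lean (p76419)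
  _root_.Summit.ValiantsHypothesis.ValiantsHypothesis.Theorems.ValuativeFlip.stub_multiplicityCount σ V V' ρ ρ' hρ hρ' h

/-- **Stub B5 — the growth gap (pure arithmetic).**  If `z + 1 ≤ N` then for some `δ` (e.g.
`δ = (n+1)^z · N!`) one has `(nδ + 1)^z < C(δ+N, N)`: indeed `C(δ+N,N) = ∏_{i=1}^N (δ+i)/i ≥ (δ+1)^N / N!`,
`(nδ+1)^z ≤ (n+1)^z (δ+1)^z` and `N ≥ z+1`.  Size S (~80 lines).  [folklore] -/
theorem stub_growthGap (n z N : ℕ) (h : z + 1 ≤ N) :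
    ∃ δ : ℕ, (n * δ + 1) ^ z < Nat.choose (δ + N) N :=
  -- LANDED: Theorems/ValuativeGCTValuativeFlipGrowthGap.lean (p76351)
  _root_.Summit.ValiantsHypothesis.ValiantsHypothesis.Theorems.ValuativeFlip.stub_growthGap n z N h

/-- **Stub B6 — the bridge: from a dimension gap in `ℂ[End W]` to a crux-weight witness at `m = n`.**
Assume the counting lemma (B4, hypothesis `hcount`, same statement).  Let `n ≥ 1`, `δ`, and suppose that inside
`R = ℂ[End W]` (`W = ℂ^{n×n}`, variables `X (j, i)`) the explicit untruncated module
`M' = Hom_{nδ} ∩ sandInv ∩ trInv` (row-wise unimodular sandwiches and row-wise transpose — the line's `E` without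
its weight clause) has smaller dimension than `genericOrbitMap_{per_n}(ℂ[Sym^n]_δ)` (`≅ ℂ[Δ_n(per_n)]_δ`, since
`orbitCoordToPoly` is injective).  Then some `λ ⊢ nδ` with `≤ n²` parts has
`dim (M' ∩ HWV_{λ*}) < orbitMultiplicity(per_n)(λ*)` — the registered bottom flip for THIS `δ`.
Why true: the LEFT translation `(g·G)(A) = G(g⁻¹A)` (algebra maps `X (p) ↦ ∑_l (g⁻¹) p.1 l • X (l, p.2)`, verbatim
the crux's Borel clause) is a representation `λ_L` of `GL(MatIdx n)` on `R`, rational on every finite-dimensional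
stable subspace (coefficients polynomial in `g⁻¹ = adj g / det g`, degree `≤ nδ`); `M'` is `λ_L`-stable (left and
right actions commute, degree is kept) and `highestWeightSpace (λ_L|M') χ = M' ∩ hwSp χ` by unfolding.  On the per
side `V = orbitCoordRingDeg per_n n δ` with `orbitCoordRepDeg` (rational: `isRationalRep_orbitCoordRepDeg`; finite:
`finiteDimensional_orbitCoordRingDeg`) has `dim V = dim genericOrbitMap(Hom_δ)` (`orbitCoordToPoly ∘ mk = genericOrbitMap`,
`orbitCoordToPoly_injective`).  `hcount` gives `χ` with `mult_{M'} χ < mult_V χ`; `mult_V χ ≤ orbitMultiplicity χ`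
(highest-weight vectors of a subrepresentation are highest-weight vectors of the whole,
`mem_highestWeightSpace_toRepresentation_iff`; the whole space is finite-dimensional,
`finiteDimensional_highestWeightSpace_orbitCoordRep_holds`); `mult_V χ ≥ 1` makes `χ` a highest weight of
`paddedPerOrbitRep ℂ n n`, hence `χ = (dualOfPartition (n*n) λ).toMatIdx`, `λ ⊢ n·d`, `≤ n²` parts
(`exists_eq_toMatIdx_of_hasHighestWeight_paddedPerOrbitRep`), and `d = δ` because a weight occurring in degree `δ`
has size `-nδ` (`size_eq_of_mem_orbitCoordRingDeg_of_mem_highestWeightSpace`, `size_toMatIdx_dualOfPartition`,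
`n ≠ 0`).  Size L (~500 lines, all ingredients in the tree; the complete ValuativeBound proof
`Cruxes/ValuativeBound/TRIAGE-r1-3-ValuativeBoundProof.lean` shows the `orbitCoordToPoly` patterns — copy, do not
import `Cruxes`).  [BLMW 2011 §5.2; tree `SchurWeylPlethysmKroneckerBoundProofs` §1, `GCTObstructions`,
`GCTObstructionsWeightForm`, `CoordRepRational`, `SchurWeylPlethysmOrbitWeightsProofs`] -/
theorem stub_bottomBridge
    (hcount : ∀ (σ : Type) [Fintype σ] [LinearOrder σ]
      (V : Type) [AddCommGroup V] [Module ℂ V] [FiniteDimensional ℂ V]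
      (V' : Type) [AddCommGroup V'] [Module ℂ V'] [FiniteDimensional ℂ V']
      (ρ : Representation ℂ (GL σ ℂ) V) (ρ' : Representation ℂ (GL σ ℂ) V'),
      IsRationalRep ρ → IsRationalRep ρ' → Module.finrank ℂ V' < Module.finrank ℂ V →
        ∃ χ : Weight σ, hwMultiplicity ρ' χ < hwMultiplicity ρ χ)
    (n : ℕ) [NeZero n] (δ : ℕ)
    (hgap : Module.finrank ℂ ↥(MvPolynomial.homogeneousSubmodule (MatIdx n × MatIdx n) ℂ (n * δ) ⊓
        ((⨅ (P : Matrix (Fin n) (Fin n) ℂ) (Q : Matrix (Fin n) (Fin n) ℂ) (_ : P.det = 1) (_ : Q.det = 1),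
            LinearMap.ker ((MvPolynomial.aeval fun p : MatIdx n × MatIdx n =>
                ∑ l : MatIdx n, (P (ofLex p.2).1 (ofLex l).1 * Q (ofLex l).2 (ofLex p.2).2) •
                  (MvPolynomial.X (p.1, l) : MvPolynomial (MatIdx n × MatIdx n) ℂ)).toLinearMap -
              (LinearMap.id : MvPolynomial (MatIdx n × MatIdx n) ℂ →ₗ[ℂ] MvPolynomial (MatIdx n × MatIdx n) ℂ))) ⊓
          LinearMap.ker ((MvPolynomial.aeval fun p : MatIdx n × MatIdx n =>
              (MvPolynomial.X (p.1, toLex ((ofLex p.2).2, (ofLex p.2).1)) :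
                MvPolynomial (MatIdx n × MatIdx n) ℂ)).toLinearMap -
            (LinearMap.id : MvPolynomial (MatIdx n × MatIdx n) ℂ →ₗ[ℂ] MvPolynomial (MatIdx n × MatIdx n) ℂ)))) <
      Module.finrank ℂ ↥((MvPolynomial.homogeneousSubmodule (DegIdx (MatIdx n) n) ℂ δ).map
        (genericOrbitMap (paddedPerFormLex ℂ n n) n).toLinearMap)) :
    ∃ lam : Nat.Partition (n * δ), lam.parts.card ≤ n * n ∧
      Module.finrank ℂ ↥(MvPolynomial.homogeneousSubmodule (MatIdx n × MatIdx n) ℂ (n * δ) ⊓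
          ((⨅ (P : Matrix (Fin n) (Fin n) ℂ) (Q : Matrix (Fin n) (Fin n) ℂ) (_ : P.det = 1) (_ : Q.det = 1),
              LinearMap.ker ((MvPolynomial.aeval fun p : MatIdx n × MatIdx n =>
                  ∑ l : MatIdx n, (P (ofLex p.2).1 (ofLex l).1 * Q (ofLex l).2 (ofLex p.2).2) •
                    (MvPolynomial.X (p.1, l) : MvPolynomial (MatIdx n × MatIdx n) ℂ)).toLinearMap -
                (LinearMap.id : MvPolynomial (MatIdx n × MatIdx n) ℂ →ₗ[ℂ] MvPolynomial (MatIdx n × MatIdx n) ℂ))) ⊓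
            LinearMap.ker ((MvPolynomial.aeval fun p : MatIdx n × MatIdx n =>
                (MvPolynomial.X (p.1, toLex ((ofLex p.2).2, (ofLex p.2).1)) :
                  MvPolynomial (MatIdx n × MatIdx n) ℂ)).toLinearMap -
              (LinearMap.id : MvPolynomial (MatIdx n × MatIdx n) ℂ →ₗ[ℂ] MvPolynomial (MatIdx n × MatIdx n) ℂ))) ⊓
          (⨅ (g : Matrix.GeneralLinearGroup (MatIdx n) ℂ) (_ : IsUpperTriangular g),
              LinearMap.ker ((MvPolynomial.aeval fun p : MatIdx n × MatIdx n =>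
                  ∑ l : MatIdx n, ((g⁻¹ : Matrix.GeneralLinearGroup (MatIdx n) ℂ) :
                    Matrix (MatIdx n) (MatIdx n) ℂ) p.1 l •
                      (MvPolynomial.X (l, p.2) : MvPolynomial (MatIdx n × MatIdx n) ℂ)).toLinearMap -
                weightChar ((Weight.dualOfPartition (n * n) lam).toMatIdx : Weight (MatIdx n)) g •
                  (LinearMap.id : MvPolynomial (MatIdx n × MatIdx n) ℂ →ₗ[ℂ] MvPolynomial (MatIdx n × MatIdx n) ℂ)))) <
        orbitMultiplicity ℂ (paddedPerFormLex ℂ n n) n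
          ((Weight.dualOfPartition (n * n) lam).toMatIdx : Weight (MatIdx n)) :=
  -- LANDED: Theorems/ValuativeGCTValuativeFlipBottomBridge.lean (p77903)
  _root_.Summit.ValiantsHypothesis.ValiantsHypothesis.Theorems.ValuativeFlip.stub_bottomBridge hcount n δ hgap

/-! ## Bookkeeping (sorry-free): local names for the inline objects, verbatim -/

/-- Index type of the coordinates `A (j, i)` of `End(ℂ^{m×m})` (row slot `j`, matrix position `i`). -/
abbrev Idx (m : ℕ) : Type := MatIdx m × MatIdx m

/-- Variables of the jet ring: tangential `x (j, k)` along `L_U` and normal `Y (j, i)`. -/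
abbrev JIdx (m d : ℕ) : Type := (MatIdx m × Fin d) ⊕ Idx m

/-- Left `B`-semi-invariance of weight `χ` — verbatim the crux's fourth factor. -/
def hwSp (m : ℕ) (χ : Weight (MatIdx m)) : Submodule ℂ (MvPolynomial (Idx m) ℂ) :=
  ⨅ (g : Matrix.GeneralLinearGroup (MatIdx m) ℂ) (_ : IsUpperTriangular g),
    LinearMap.ker ((MvPolynomial.aeval (R := ℂ) fun p : MatIdx m × MatIdx m =>
        ∑ l : MatIdx m, ((g⁻¹ : Matrix.GeneralLinearGroup (MatIdx m) ℂ) :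
          Matrix (MatIdx m) (MatIdx m) ℂ) p.1 l • MvPolynomial.X (l, p.2)).toLinearMap -
      weightChar χ g • LinearMap.id (R := ℂ) (M := MvPolynomial (MatIdx m × MatIdx m) ℂ))

/-- Right invariance under the abstract `End`-stabiliser of `det_m` — verbatim the crux's third factor. -/
def stabInv (m : ℕ) : Submodule ℂ (MvPolynomial (Idx m) ℂ) :=
  ⨅ (M : Matrix (MatIdx m) (MatIdx m) ℂ)
    (_ : linSubst (MatIdx m) ℂ M (detFormLex ℂ m) = detFormLex ℂ m),
    LinearMap.ker ((MvPolynomial.aeval (R := ℂ) fun p : MatIdx m × MatIdx m =>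
        ∑ l : MatIdx m, M l p.2 • MvPolynomial.X (p.1, l)).toLinearMap -
      LinearMap.id (R := ℂ) (M := MvPolynomial (MatIdx m × MatIdx m) ℂ))

/-- Invariance under the row-wise unimodular sandwiches `X_j ↦ P X_j Q` (explicit). -/
def sandInv (m : ℕ) : Submodule ℂ (MvPolynomial (Idx m) ℂ) :=
  ⨅ (P : Matrix (Fin m) (Fin m) ℂ) (Q : Matrix (Fin m) (Fin m) ℂ) (_ : P.det = 1) (_ : Q.det = 1),
    LinearMap.ker ((MvPolynomial.aeval (R := ℂ) fun p : MatIdx m × MatIdx m =>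
        ∑ l : MatIdx m, (P (ofLex p.2).1 (ofLex l).1 * Q (ofLex l).2 (ofLex p.2).2) •
          MvPolynomial.X (p.1, l)).toLinearMap -
      LinearMap.id (R := ℂ) (M := MvPolynomial (MatIdx m × MatIdx m) ℂ))

/-- Invariance under the row-wise transpose `X_j ↦ X_jᵀ` (explicit). -/
def trInv (m : ℕ) : Submodule ℂ (MvPolynomial (Idx m) ℂ) :=
  LinearMap.ker ((MvPolynomial.aeval (R := ℂ) fun p : MatIdx m × MatIdx m =>
      (MvPolynomial.X (p.1, toLex ((ofLex p.2).2, (ofLex p.2).1)) :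
        MvPolynomial (MatIdx m × MatIdx m) ℂ)).toLinearMap -
    LinearMap.id (R := ℂ) (M := MvPolynomial (MatIdx m × MatIdx m) ℂ))

/-- The vanishing ideal `P_U` of the gap locus `L_U = {A | every row of A lies in U}` — verbatim. -/
def vanI (m : ℕ) (U : Submodule ℂ (MatIdx m → ℂ)) : Ideal (MvPolynomial (Idx m) ℂ) :=
  MvPolynomial.vanishingIdeal ℂ
    {p : MatIdx m × MatIdx m → ℂ | ∀ j : MatIdx m, (fun i => p (j, i)) ∈ U}

/-- The crux's valuative truncation in degree `D`, threshold `t` (abstract stabiliser). -/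
def truncT (m D : ℕ) (U : Submodule ℂ (MatIdx m → ℂ)) (χ : Weight (MatIdx m)) (t : ℕ) :
    Submodule ℂ (MvPolynomial (Idx m) ℂ) :=
  MvPolynomial.homogeneousSubmodule (MatIdx m × MatIdx m) ℂ D ⊓ ((vanI m U) ^ t).restrictScalars ℂ ⊓
    stabInv m ⊓ hwSp m χ

/-- The explicit untruncated space `E(χ)` of stub 4 (symmetric-Kronecker space, explicit group). -/
def explT (m D : ℕ) (χ : Weight (MatIdx m)) : Submodule ℂ (MvPolynomial (Idx m) ℂ) :=
  MvPolynomial.homogeneousSubmodule (MatIdx m × MatIdx m) ℂ D ⊓ (sandInv m ⊓ trInv m) ⊓ hwSp m χ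

/-- The jet map of order `s` along `L_U`, `u` a spanning family of `U` — verbatim stubs 2 and 4. -/
def jetMap (m d : ℕ) (u : Fin d → MatIdx m → ℂ) (s : ℕ) :
    MvPolynomial (Idx m) ℂ →ₗ[ℂ] MvPolynomial (JIdx m d) ℂ :=
  (∑ e ∈ Finset.range (s + 1),
      MvPolynomial.weightedHomogeneousComponent
        (Sum.elim (fun _ => 0) (fun _ => 1) : (MatIdx m × Fin d) ⊕ (MatIdx m × MatIdx m) → ℕ) e) ∘ₗ
    (MvPolynomial.aeval (R := ℂ) fun p : MatIdx m × MatIdx m =>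
        (∑ k : Fin d, u k p.2 • MvPolynomial.X (Sum.inl (p.1, k))) +
          MvPolynomial.X (Sum.inr p)).toLinearMap

/-- The τ-symmetrised level-`δ` blow-up determinant `G_T = F_T + F_{Tᵀ}` — verbatim stubs 3 and 4. -/
def symBlowup (m δ : ℕ) (T : MatIdx m → Matrix (Fin δ) (Fin δ) ℂ) : MvPolynomial (Idx m) ℂ :=
  (Matrix.of fun a b : Fin δ × Fin m =>
      ∑ j : MatIdx m, T j a.1 b.1 • MvPolynomial.X (R := ℂ) (j, toLex (a.2, b.2))).det +
  (Matrix.of fun a b : Fin δ × Fin m =>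
      ∑ j : MatIdx m, (T j)ᵀ a.1 b.1 • MvPolynomial.X (R := ℂ) (j, toLex (a.2, b.2))).det

/-- The certificate module `V_δ`: span of all τ-symmetrised level-`δ` blow-up determinants. -/
def blowupSpan (m δ : ℕ) : Submodule ℂ (MvPolynomial (Idx m) ℂ) :=
  Submodule.span ℂ (Set.range (symBlowup m δ))

/-! ### The stubs restated over the local names (definitional unfolding only) -/

/-- The crux, unbundled (definitional). -/
theorem valuativeFlip_iff :
    Summit.ValiantsHypothesis.ValiantsHypothesis.Theses.ValuativeGCT.ValuativeFlip ↔
      ∀ c : ℕ, ∃ n₀ : ℕ, ∀ n ≥ n₀, ∀ (m : ℕ) [NeZero m], n ≤ m → m ≤ 2 ^ ((Nat.log 2 n + c) ^ c) →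
        ∃ (U : Submodule ℂ (MatIdx m → ℂ)) (r δ : ℕ) (lam : Nat.Partition (m * δ)),
          (∀ u ∈ U, (Matrix.of fun a b : Fin m => u (toLex (a, b))).rank ≤ r) ∧
          lam.parts.card ≤ m * m ∧
          Module.finrank ℂ ↥(truncT m (m * δ) U (Weight.dualOfPartition (m * m) lam).toMatIdx
              (δ * (m - r))) <
            orbitMultiplicity ℂ (paddedPerFormLex ℂ n m) m (Weight.dualOfPartition (m * m) lam).toMatIdx :=
  Iff.rfl

/-- Stub 1 over the local names. -/
theorem stabInv_le (m : ℕ) : stabInv m ≤ sandInv m ⊓ trInv m :=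
  stub_stabInv_le_explicit m

/-- Stub 2 over the local names. -/
theorem jetRankNullity (m d : ℕ) (u : Fin d → MatIdx m → ℂ) (U : Submodule ℂ (MatIdx m → ℂ))
    (hU : Submodule.span ℂ (Set.range u) = U) (D t s : ℕ) (hst : s < t)
    (W : Submodule ℂ (MvPolynomial (Idx m) ℂ))
    (hW : W ≤ MvPolynomial.homogeneousSubmodule (MatIdx m × MatIdx m) ℂ D) :
    Module.finrank ℂ ↥(W ⊓ ((vanI m U) ^ t).restrictScalars ℂ) +
      Module.finrank ℂ ↥(W.map (jetMap m d u s)) ≤ Module.finrank ℂ ↥W :=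
  stub_jetRankNullity m d u U hU D t s hst W hW

theorem mem_sandInv_iff {m : ℕ} {G : MvPolynomial (Idx m) ℂ} :
    G ∈ sandInv m ↔ ∀ P Q : Matrix (Fin m) (Fin m) ℂ, P.det = 1 → Q.det = 1 →
      MvPolynomial.aeval (R := ℂ) (fun p : MatIdx m × MatIdx m =>
        ∑ l : MatIdx m, (P (ofLex p.2).1 (ofLex l).1 * Q (ofLex l).2 (ofLex p.2).2) •
          MvPolynomial.X (R := ℂ) (p.1, l)) G = G := by
  simp only [sandInv, Submodule.mem_iInf, LinearMap.mem_ker, LinearMap.sub_apply, sub_eq_zero,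
    AlgHom.toLinearMap_apply, LinearMap.id_coe, id_eq]

theorem mem_trInv_iff {m : ℕ} {G : MvPolynomial (Idx m) ℂ} :
    G ∈ trInv m ↔ MvPolynomial.aeval (R := ℂ) (fun p : MatIdx m × MatIdx m =>
        MvPolynomial.X (R := ℂ) (p.1, toLex ((ofLex p.2).2, (ofLex p.2).1))) G = G := by
  simp only [trInv, LinearMap.mem_ker, LinearMap.sub_apply, sub_eq_zero,
    AlgHom.toLinearMap_apply, LinearMap.id_coe, id_eq]

/-- Stub 3 over the local names: every symmetrised blow-up determinant lies in `Hom_{mδ} ∩ sandInv ∩ trInv`. -/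
theorem symBlowup_mem (m δ : ℕ) (T : MatIdx m → Matrix (Fin δ) (Fin δ) ℂ) :
    symBlowup m δ T ∈
      MvPolynomial.homogeneousSubmodule (MatIdx m × MatIdx m) ℂ (m * δ) ⊓ (sandInv m ⊓ trInv m) := by
  have h : (symBlowup m δ T).IsHomogeneous (m * δ) ∧
      (∀ P Q : Matrix (Fin m) (Fin m) ℂ, P.det = 1 → Q.det = 1 →
        MvPolynomial.aeval (R := ℂ) (fun p : MatIdx m × MatIdx m =>
          ∑ l : MatIdx m, (P (ofLex p.2).1 (ofLex l).1 * Q (ofLex l).2 (ofLex p.2).2) •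
            MvPolynomial.X (R := ℂ) (p.1, l)) (symBlowup m δ T) = symBlowup m δ T) ∧
      MvPolynomial.aeval (R := ℂ) (fun p : MatIdx m × MatIdx m =>
          MvPolynomial.X (R := ℂ) (p.1, toLex ((ofLex p.2).2, (ofLex p.2).1))) (symBlowup m δ T) =
        symBlowup m δ T :=
    stub_symBlowup_mem m δ T
  obtain ⟨h1, h2, h3⟩ := h
  exact Submodule.mem_inf.mpr ⟨(mem_homogeneousSubmodule _ _).mpr h1,
    Submodule.mem_inf.mpr ⟨mem_sandInv_iff.mpr h2, mem_trInv_iff.mpr h3⟩⟩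

/-- The certificate module sits inside the explicit invariants of degree `mδ`. -/
theorem blowupSpan_le (m δ : ℕ) :
    blowupSpan m δ ≤
      MvPolynomial.homogeneousSubmodule (MatIdx m × MatIdx m) ℂ (m * δ) ⊓ (sandInv m ⊓ trInv m) :=
  Submodule.span_le.mpr (Set.range_subset_iff.mpr fun T => symBlowup_mem m δ T)

/-- Stub 4b over the local names. -/
theorem censusFlipAbove :
    ∀ c : ℕ, ∃ n₀ : ℕ, ∀ n ≥ n₀, ∀ (m : ℕ) [NeZero m], n < m → m ≤ 2 ^ ((Nat.log 2 n + c) ^ c) →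
      ∃ (U : Submodule ℂ (MatIdx m → ℂ)) (r d : ℕ) (u : Fin d → MatIdx m → ℂ) (δ : ℕ)
        (lam : Nat.Partition (m * δ)),
        (∀ v ∈ U, (Matrix.of fun a b : Fin m => v (toLex (a, b))).rank ≤ r) ∧
        Submodule.span ℂ (Set.range u) = U ∧ lam.parts.card ≤ m * m ∧ 0 < δ * (m - r) ∧
        Module.finrank ℂ ↥(explT m (m * δ) (Weight.dualOfPartition (m * m) lam).toMatIdx) <
          orbitMultiplicity ℂ (paddedPerFormLex ℂ n m) m (Weight.dualOfPartition (m * m) lam).toMatIdx +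
            Module.finrank ℂ ↥((hwSp m (Weight.dualOfPartition (m * m) lam).toMatIdx ⊓ blowupSpan m δ).map
              (jetMap m d u (δ * (m - r) - 1))) :=
  stub_censusFlipAboveBottom

/-! ### The bottom flip composed from stubs B1–B6 (sorry-free glue) -/

/-- `2n² ≤ n⁴` for `n ≥ 2`. -/
theorem two_mul_sq_le_pow_four {n : ℕ} (hn : 2 ≤ n) : 2 * n ^ 2 ≤ n ^ 4 := by
  have h2 : 2 ≤ n ^ 2 := by nlinarith
  calc 2 * n ^ 2 ≤ n ^ 2 * n ^ 2 := Nat.mul_le_mul_right _ h2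
    _ = n ^ 4 := by ring

/-- Arithmetic of the exponents: `z + 1 ≤ N` for `z = n⁴ - 2n² + 2n`, `N = n⁴ - n² - 1`, `n ≥ 3`. -/
theorem exponent_gap {n : ℕ} (hn : 3 ≤ n) :
    (n ^ 4 - 2 * n ^ 2 + 2 * n) + 1 ≤ n ^ 4 - n ^ 2 - 1 := by
  have h1 : 2 * n + 3 ≤ n ^ 2 := by nlinarith
  have h2 : 2 * n ^ 2 ≤ n ^ 4 := two_mul_sq_le_pow_four (by omega)
  generalize n ^ 4 = A at *
  generalize n ^ 2 = B at *
  omega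

/-- **The bottom of every window (`m = n ≥ 3`), E-currency** — formerly the registered `stub_bottomCensusFlip`,
now a theorem composed from B1–B6: there are `δ` and `λ ⊢ nδ` (`≤ n²` parts) with
`dim E(λ) < mult_{λ*} ℂ[Δ_n(per_n)]`. -/
theorem bottomCensusFlip_of_stubs (n : ℕ) [NeZero n] (hn : 3 ≤ n) :
    ∃ (δ : ℕ) (lam : Nat.Partition (n * δ)), lam.parts.card ≤ n * n ∧
      Module.finrank ℂ ↥(explT n (n * δ) (Weight.dualOfPartition (n * n) lam).toMatIdx) <
        orbitMultiplicity ℂ (paddedPerFormLex ℂ n n) n (Weight.dualOfPartition (n * n) lam).toMatIdx := by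
  obtain ⟨hpp0, htan⟩ := stub_tangentRank n hn
  have hzN := exponent_gap hn
  obtain ⟨δ, hδ⟩ := stub_growthGap n (n ^ 4 - 2 * n ^ 2 + 2 * n) (n ^ 4 - n ^ 2 - 1) hzN
  have hN : (n ^ 4 - n ^ 2 - 1) + 1 ≤ Module.finrank ℂ ↥(Submodule.span ℂ (Set.range
      fun ab : MatIdx n × MatIdx n => MvPolynomial.X ab.1 * MvPolynomial.pderiv ab.2 (paddedPerFormLex ℂ n n))) := by
    have h9 : 2 * n ^ 2 ≤ n ^ 4 := two_mul_sq_le_pow_four (by omega)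
    have h1 : 1 ≤ n ^ 2 := Nat.one_le_pow _ _ (by omega)
    revert htan h9 h1
    generalize n ^ 4 = A
    generalize n ^ 2 = B
    intro htan h9 h1
    omega
  have h3 := stub_hilbertLowerBound (MatIdx n) (paddedPerFormLex ℂ n n) n
    (paddedPerFormLex_isHomogeneous ℂ le_rfl) hpp0 (n ^ 4 - n ^ 2 - 1) δ hN
  have h1 := stub_sliceBound n (by omega) (n * δ)
  -- finiteness of `Hom ⊓ sandInv`
  have hfin : Module.Finite ℂ ↥(MvPolynomial.homogeneousSubmodule (Idx n) ℂ (n * δ) ⊓ sandInv n) := by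
    have : Module.Finite ℂ ↥(MvPolynomial.homogeneousSubmodule (Idx n) ℂ (n * δ)) :=
      Module.Finite.iff_fg.mpr (MvPolynomial.homogeneousSubmodule_fg (Idx n) ℂ (n * δ))
    exact Submodule.finiteDimensional_of_le inf_le_left
  have hmono : Module.finrank ℂ ↥(MvPolynomial.homogeneousSubmodule (Idx n) ℂ (n * δ) ⊓ (sandInv n ⊓ trInv n)) ≤
      Module.finrank ℂ ↥(MvPolynomial.homogeneousSubmodule (Idx n) ℂ (n * δ) ⊓ sandInv n) :=
    Submodule.finrank_mono (inf_le_inf_left _ inf_le_left)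
  have hgap : Module.finrank ℂ ↥(MvPolynomial.homogeneousSubmodule (Idx n) ℂ (n * δ) ⊓ (sandInv n ⊓ trInv n)) <
      Module.finrank ℂ ↥((MvPolynomial.homogeneousSubmodule (DegIdx (MatIdx n) n) ℂ δ).map
        (genericOrbitMap (paddedPerFormLex ℂ n n) n).toLinearMap) :=
    lt_of_le_of_lt (hmono.trans h1) (lt_of_lt_of_le hδ h3)
  obtain ⟨lam, hcard, hlt⟩ := stub_bottomBridge stub_multiplicityCount n δ hgap
  exact ⟨δ, lam, hcard, hlt⟩

/-- Stub 4a over the local names: at `m = n` the explicit space flips below the per side. -/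
theorem bottomCensusFlip (n : ℕ) [NeZero n] (hn : 3 ≤ n) :
    ∃ (δ : ℕ) (lam : Nat.Partition (n * δ)), lam.parts.card ≤ n * n ∧
      Module.finrank ℂ ↥(explT n (n * δ) (Weight.dualOfPartition (n * n) lam).toMatIdx) <
        orbitMultiplicity ℂ (paddedPerFormLex ℂ n n) n (Weight.dualOfPartition (n * n) lam).toMatIdx :=
  bottomCensusFlip_of_stubs n hn

/-- The crux's truncation lies inside the explicit space (stub 1; any centre, any threshold). -/
theorem truncT_le_explT (m D : ℕ) (U : Submodule ℂ (MatIdx m → ℂ)) (χ : Weight (MatIdx m)) (t : ℕ) :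
    truncT m D U χ t ≤ explT m D χ := by
  unfold truncT explT
  exact inf_le_inf (le_inf (inf_le_left.trans inf_le_left) (inf_le_right.trans (stabInv_le m))) le_rfl

/-! ### Finiteness -/

instance finite_explT (m D : ℕ) (χ : Weight (MatIdx m)) : Module.Finite ℂ ↥(explT m D χ) := by
  have : Module.Finite ℂ ↥(MvPolynomial.homogeneousSubmodule (Idx m) ℂ D) :=
    Module.Finite.iff_fg.mpr (MvPolynomial.homogeneousSubmodule_fg (Idx m) ℂ D)
  have hle : explT m D χ ≤ MvPolynomial.homogeneousSubmodule (Idx m) ℂ D := by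
    unfold explT
    exact inf_le_left.trans inf_le_left
  exact Submodule.finiteDimensional_of_le hle

/-! ## Glue (sorry-free): the crux from the four stubs -/

/-- **`ValuativeFlip` from the line.**  Fix `c`; stub 4b gives `n₀`; take `max n₀ 3`.  At the BOTTOM
`m = n` of the window, stub 4a gives `δ, λ` with `dim E(λ) < mult_{per_n}(λ*)`, and the crux's truncation at the
no-cut centre `U = ⊥`, `r = 0` lies inside `E(λ)` (stub 1), so `(⊥, 0, δ, λ)` is a crux witness.  ABOVE the
bottom, stub 4b gives an admissible centre `(U, r)` with spanning family `u`, a degree `δ`, a shape `λ` and the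
census inequality `dim E(λ) < mult_pp(λ*) + dim J(HWV ∩ V_δ)`; stub 1 puts the crux's truncation `T_U(λ)`
(threshold `t = δ(m-r) ≥ 1`) inside `E(λ) ∩ P_U^t`; stub 2 (with `W = E(λ)`, `s = t - 1`) gives
`dim (E ∩ P_U^t) + dim J(E) ≤ dim E`; stub 3 puts `HWV ∩ V_δ` inside `E`, so `dim J(HWV ∩ V_δ) ≤ dim J(E)`;
hence `dim T_U(λ) < mult_pp(λ*)`, the crux's witness at `(n, m)`. -/
theorem ValuativeFlip_of :
    Summit.ValiantsHypothesis.ValiantsHypothesis.Theses.ValuativeGCT.ValuativeFlip := by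
  rw [valuativeFlip_iff]
  intro c
  obtain ⟨n₀, hn₀⟩ := censusFlipAbove c
  refine ⟨max n₀ 3, fun n hn m _ hnm hm => ?_⟩
  have hn₀' : n₀ ≤ n := le_of_max_le_left hn
  have hn3 : 3 ≤ n := le_of_max_le_right hn
  rcases hnm.eq_or_lt with rfl | hlt'
  · -- BOTTOM `m = n`: no-cut centre `U = ⊥`, `r = 0`
    obtain ⟨δ, lam, hcard, hlt⟩ := bottomCensusFlip n hn3
    refine ⟨⊥, 0, δ, lam, ?_, hcard, ?_⟩
    · intro u hu
      rw [Submodule.mem_bot] at hu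
      subst hu
      have h0 : (Matrix.of fun a b : Fin n => (0 : MatIdx n → ℂ) (toLex (a, b))) = 0 := by
        ext a b
        simp
      rw [h0, Matrix.rank_zero]
    · exact lt_of_le_of_lt (Submodule.finrank_mono (truncT_le_explT n (n * δ) ⊥ _ (δ * (n - 0)))) hlt
  · -- ABOVE THE BOTTOM `n < m`
    obtain ⟨U, r, d, u, δ, lam, hU, hspan, hcard, hpos, hlt⟩ := hn₀ n hn₀' m hlt' hm
    refine ⟨U, r, δ, lam, hU, hcard, ?_⟩
    -- the explicit untruncated space `E(λ)` and the threshold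
    have hW : explT m (m * δ) (Weight.dualOfPartition (m * m) lam).toMatIdx ≤
        MvPolynomial.homogeneousSubmodule (MatIdx m × MatIdx m) ℂ (m * δ) := by
      unfold explT
      exact inf_le_left.trans inf_le_left
    -- stub 2: rank–nullity modulo sub-threshold jets on `E(λ)`
    have h2 := jetRankNullity m d u U hspan (m * δ) (δ * (m - r)) (δ * (m - r) - 1) (by omega)
      (explT m (m * δ) (Weight.dualOfPartition (m * m) lam).toMatIdx) hW
    -- stub 1: the crux's truncation lies in `E(λ) ∩ P_U^t`
    have hT : truncT m (m * δ) U (Weight.dualOfPartition (m * m) lam).toMatIdx (δ * (m - r)) ≤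
        explT m (m * δ) (Weight.dualOfPartition (m * m) lam).toMatIdx ⊓
          ((vanI m U) ^ (δ * (m - r))).restrictScalars ℂ := by
      refine le_inf (truncT_le_explT m (m * δ) U _ _) ?_
      unfold truncT
      exact inf_le_left.trans (inf_le_left.trans inf_le_right)
    have hTfin : Module.Finite ℂ ↥(explT m (m * δ) (Weight.dualOfPartition (m * m) lam).toMatIdx ⊓
        ((vanI m U) ^ (δ * (m - r))).restrictScalars ℂ) :=
      Submodule.finiteDimensional_of_le inf_le_left
    have hTle := Submodule.finrank_mono hT
    -- stub 3: the certificates lie in `E(λ)`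
    have hV : hwSp m (Weight.dualOfPartition (m * m) lam).toMatIdx ⊓ blowupSpan m δ ≤
        explT m (m * δ) (Weight.dualOfPartition (m * m) lam).toMatIdx := by
      unfold explT
      exact le_inf (inf_le_right.trans (blowupSpan_le m δ)) inf_le_left
    have hVle := Submodule.finrank_mono (Submodule.map_mono (f := jetMap m d u (δ * (m - r) - 1)) hV)
    omega

/-! ## Logical position of the crux (third line lead prover-line-stmt-ValiantsHypothesis-12624-2, 2026-08-16)

Three sorry-free pieces of glue and ONE registered stub (H2, LANDED p86058) which together make the crux's place in the
Mulmuley–Sohoni implication web a theorem of the tree instead of prose (tree copies: H2 `Theorems/ValuativeGCTValuativeFlipKroneckerCensus`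
p86058; H1 + H3b `Theorems/ValuativeGCTValuativeFlipAboveBottom` p86585; H3a `Theorems/ValuativeGCTValuativeFlipOfKroneckerFlip` p88164
(submitted); per-anchor's bottom `Theorems/ValuativeGCTValuativeFlipPerAnchorBottom` p86433):

* `stub_truncT0_le_kronecker` (H2, TRUE, landed p86058): the UNTRUNCATED census space `T₀(λ)` — abstract
  `Stab_End(det_m)`-invariant `B`-semi-invariants of weight `λ*` in `ℂ[End W]_{mδ}`, i.e. the crux's `T` with the
  valuative factor dropped — has dimension at most the rectangular Kronecker coefficient `g(λ, m×δ, m×δ)`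
  (BLMW 2011 Prop. 5.2.1 run on `ℂ[End W]` instead of `ℂ[Δ det_m]`: the bound-space argument
  `exists_mem_boundSpace` / `card_mul_finrank_boundSpace` / `character_kronInvariantsPermRep` of
  `SchurWeylPlethysmKroneckerBoundProofs.lean`, fed with `G(bA) = χ(b)⁻¹ G(A)` and `G(A·(a ⊗ b)) = G(A)`);
* `valuativeFlip_of_gctKroneckerFlip` (H3a): `GCTMult.GctKroneckerFlip → ValuativeFlip` (stmt-0888 ⇒ this crux;
  `U = ⊥`, `r = 0`, `T ≤ T₀`, H2);
* `gctMultFlip_of_valuativeFlip` (H3b): `ValuativeBound → ValuativeFlip → GCTMult.GctMultFlip` (this crux ⇒ stmt-0887);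
* `valuativeFlip_iff_aboveBottom` (H1): the crux is EQUIVALENT to its padded part `n < m` (the bottom `m = n` is the
  landed theorem `bottomCensusFlip`).
So, formally: `sk/g-flip (0888) ⇒ ValuativeFlip (12624) ⇔ ValuativeFlip above the bottom ⇒ (with 12625) mult-flip (0887)`.
-/

/-- **stub_truncT0_le_kronecker** (H2) — THE UNTRUNCATED CENSUS IS BOUNDED BY THE RECTANGULAR KRONECKER
COEFFICIENT.  For `λ ⊢ mδ` with at most `m²` parts, the space of `G ∈ ℂ[End(ℂ^{m×m})]` homogeneous of degree
`mδ`, invariant under `A ↦ A·M` for every `M` in the `End`-stabiliser of `det_m` and `B`-semi-invariant of weight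
`λ* = (dualOfPartition (m·m) λ).toMatIdx` under `A ↦ g⁻¹A` (the crux's `T` without its valuative factor, verbatim)
has dimension `≤ g(λ, m×δ, m×δ)`.  Why true: BLMW 2011 §5.2 Prop. 5.2.1 — `G(bA) = χ(b)⁻¹G(A)` for upper triangular
`b` (the Borel clause at `g = b⁻¹`, `weightChar_inv`), `G(A·(a ⊗ b)) = G(A)` for `a, b` upper-triangular unimodular
(`linSubstRep_reindexGL_kronFin_detFormLex`: `a ⊗ b` stabilises `det_m`), so after `transportPoly (matIdxEquiv m)` the
hypotheses of `exists_mem_boundSpace` hold with `X = kronInvariants`, `S = IsKronUnimodularBorel`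
(`mem_kronInvariants_of_forall`); `transportPoly` and `L ↦ pairPoly L` are linear, the former injective, so
`dim T₀ ≤ dim boundSpace = g(λ, □, □)` (tail of `orbitMultiplicity_det_le_kroneckerCoeff_holds`:
`card_mul_finrank_boundSpace`, `character_transposedPermRep_dualOfPartition`, `character_kronInvariantsPermRep`,
`kroneckerCoeff_eq_sum_spechtCharacter_holds`, `size_toMatIdx_dualOfPartition`, `toMatIdx_comp_matIdxEquiv`).
Size M (~200 lines).  [BLMW 2011 §5.2 Prop. 5.2.1, arXiv:0907.2850; Fulton–Harris Lemma 6.23] -/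
theorem stub_truncT0_le_kronecker (m δ : ℕ) [NeZero m] (lam : Nat.Partition (m * δ))
    (hlam : lam.parts.card ≤ m * m) :
    Module.finrank ℂ ↥(MvPolynomial.homogeneousSubmodule (MatIdx m × MatIdx m) ℂ (m * δ) ⊓
        (⨅ (M : Matrix (MatIdx m) (MatIdx m) ℂ)
          (_ : linSubst (MatIdx m) ℂ M (detFormLex ℂ m) = detFormLex ℂ m),
          LinearMap.ker ((MvPolynomial.aeval fun p : MatIdx m × MatIdx m =>
              ∑ l : MatIdx m, M l p.2 •
                (MvPolynomial.X (p.1, l) : MvPolynomial (MatIdx m × MatIdx m) ℂ)).toLinearMap -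
            (LinearMap.id : MvPolynomial (MatIdx m × MatIdx m) ℂ →ₗ[ℂ] MvPolynomial (MatIdx m × MatIdx m) ℂ))) ⊓
        (⨅ (g : Matrix.GeneralLinearGroup (MatIdx m) ℂ) (_ : IsUpperTriangular g),
          LinearMap.ker ((MvPolynomial.aeval fun p : MatIdx m × MatIdx m =>
              ∑ l : MatIdx m, ((g⁻¹ : Matrix.GeneralLinearGroup (MatIdx m) ℂ) :
                Matrix (MatIdx m) (MatIdx m) ℂ) p.1 l •
                  (MvPolynomial.X (l, p.2) : MvPolynomial (MatIdx m × MatIdx m) ℂ)).toLinearMap -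
            weightChar ((Weight.dualOfPartition (m * m) lam).toMatIdx : Weight (MatIdx m)) g •
              (LinearMap.id : MvPolynomial (MatIdx m × MatIdx m) ℂ →ₗ[ℂ] MvPolynomial (MatIdx m × MatIdx m) ℂ)))) ≤
      kroneckerCoeff ℂ lam (Nat.Partition.rectangle m δ) (Nat.Partition.rectangle m δ) :=
  -- LANDED (wave 1, p86058): `Theorems/ValuativeGCTValuativeFlipKroneckerCensus.lean`.
  _root_.Summit.ValiantsHypothesis.ValiantsHypothesis.Theorems.ValuativeFlip.stub_truncT0_le_kronecker m δ lam hlam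

/-- The untruncated census space `T₀(χ) = Hom_D ∩ stabInv ∩ HWV_χ` over the local names. -/
def truncT₀ (m D : ℕ) (χ : Weight (MatIdx m)) : Submodule ℂ (MvPolynomial (Idx m) ℂ) :=
  MvPolynomial.homogeneousSubmodule (MatIdx m × MatIdx m) ℂ D ⊓ stabInv m ⊓ hwSp m χ

/-- Dropping the valuative factor: `T_U(χ, t) ≤ T₀(χ)` for every centre and threshold. -/
theorem truncT_le_truncT₀ (m D : ℕ) (U : Submodule ℂ (MatIdx m → ℂ)) (χ : Weight (MatIdx m)) (t : ℕ) :
    truncT m D U χ t ≤ truncT₀ m D χ := by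
  unfold truncT truncT₀
  exact inf_le_inf (inf_le_inf inf_le_left le_rfl) le_rfl

instance finite_truncT₀ (m D : ℕ) (χ : Weight (MatIdx m)) : Module.Finite ℂ ↥(truncT₀ m D χ) := by
  have : Module.Finite ℂ ↥(MvPolynomial.homogeneousSubmodule (Idx m) ℂ D) :=
    Module.Finite.iff_fg.mpr (MvPolynomial.homogeneousSubmodule_fg (Idx m) ℂ D)
  have hle : truncT₀ m D χ ≤ MvPolynomial.homogeneousSubmodule (Idx m) ℂ D := by
    unfold truncT₀
    exact inf_le_left.trans inf_le_left
  exact Submodule.finiteDimensional_of_le hle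

/-- H2 over the local names: `dim T₀(λ*) ≤ g(λ, m×δ, m×δ)`. -/
theorem truncT₀_le_kronecker (m δ : ℕ) [NeZero m] (lam : Nat.Partition (m * δ)) (hlam : lam.parts.card ≤ m * m) :
    Module.finrank ℂ ↥(truncT₀ m (m * δ) (Weight.dualOfPartition (m * m) lam).toMatIdx) ≤
      kroneckerCoeff ℂ lam (Nat.Partition.rectangle m δ) (Nat.Partition.rectangle m δ) :=
  stub_truncT0_le_kronecker m δ lam hlam

/-- **H3a — the classical Kronecker flip implies the crux.**  `GCTMult.GctKroneckerFlip` (stmt-ValiantsHypothesis-0888: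
`g(λ, m×d, m×d) < mult_{λ*} ℂ[Δ(X₀₀^{m-n} per_n)]` somewhere in every window) gives `ValuativeFlip` with the no-cut
centre `U = ⊥`, `r = 0`: `dim T_⊥(λ) ≤ dim T₀(λ) ≤ g(λ, □, □) < mult_pp(λ*)` (H2).  [BLMW 2011 §5.2; this line] -/
theorem valuativeFlip_of_gctKroneckerFlip
    (h : Summit.ValiantsHypothesis.ValiantsHypothesis.Theses.GCTMult.GctKroneckerFlip) :
    Summit.ValiantsHypothesis.ValiantsHypothesis.Theses.ValuativeGCT.ValuativeFlip := by
  rw [valuativeFlip_iff]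
  intro c
  obtain ⟨n₀, hn₀⟩ := h c
  refine ⟨n₀, fun n hn m _ hnm hm => ?_⟩
  obtain ⟨d, lam, hcard, hlt⟩ := hn₀ n hn m hnm hm
  refine ⟨⊥, 0, d, lam, ?_, hcard, ?_⟩
  · intro u hu
    rw [Submodule.mem_bot] at hu
    subst hu
    have h0 : (Matrix.of fun a b : Fin m => (0 : MatIdx m → ℂ) (toLex (a, b))) = 0 := by
      ext a b
      simp
    rw [h0, Matrix.rank_zero]
  · exact lt_of_le_of_lt ((Submodule.finrank_mono (truncT_le_truncT₀ m (m * d) ⊥ _ (d * (m - 0)))).trans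
      (truncT₀_le_kronecker m d lam hcard)) hlt

/-- **H3b — the crux implies the classical multiplicity flip** (given the route's `ValuativeBound`, stmt-12625):
`K_m(λ*) ≤ dim T_U(λ) < mult_pp(λ*)`, so `χ := λ*` witnesses `GCTMult.GctMultFlip` (stmt-ValiantsHypothesis-0887).
Pure logic (the route's `closes` minus its last two steps). [this line] -/
theorem gctMultFlip_of_valuativeFlip
    (hB : Summit.ValiantsHypothesis.ValiantsHypothesis.Theses.ValuativeGCT.ValuativeBound)
    (hF : Summit.ValiantsHypothesis.ValiantsHypothesis.Theses.ValuativeGCT.ValuativeFlip) :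
    Summit.ValiantsHypothesis.ValiantsHypothesis.Theses.GCTMult.GctMultFlip := by
  intro c
  obtain ⟨n₀, hn₀⟩ := hF c
  refine ⟨n₀, fun n hn m _ hnm hm => ?_⟩
  obtain ⟨U, r, δ, lam, hU, hcard, hlt⟩ := hn₀ n hn m hnm hm
  exact ⟨_, lt_of_le_of_lt (hB m U r hU δ lam hcard) hlt⟩

/-- **H1 — the crux is its padded part.**  `ValuativeFlip` is equivalent to the same statement with `n ≤ m`
sharpened to `n < m`: the bottom `m = n` of every window is the landed theorem `bottomCensusFlip` (B1–B6) with the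
no-cut centre (`truncT_le_explT`, stub 1).  So promoting `stub_censusFlipAboveBottom` means: an item equivalent to the
crux itself (in census currency), implied by stmt-0888 (H3a) and implying stmt-0887 given stmt-12625 (H3b). [this line] -/
theorem valuativeFlip_iff_aboveBottom :
    Summit.ValiantsHypothesis.ValiantsHypothesis.Theses.ValuativeGCT.ValuativeFlip ↔
      ∀ c : ℕ, ∃ n₀ : ℕ, ∀ n ≥ n₀, ∀ (m : ℕ) [NeZero m], n < m → m ≤ 2 ^ ((Nat.log 2 n + c) ^ c) →
        ∃ (U : Submodule ℂ (MatIdx m → ℂ)) (r δ : ℕ) (lam : Nat.Partition (m * δ)),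
          (∀ u ∈ U, (Matrix.of fun a b : Fin m => u (toLex (a, b))).rank ≤ r) ∧
          lam.parts.card ≤ m * m ∧
          Module.finrank ℂ ↥(truncT m (m * δ) U (Weight.dualOfPartition (m * m) lam).toMatIdx
              (δ * (m - r))) <
            orbitMultiplicity ℂ (paddedPerFormLex ℂ n m) m (Weight.dualOfPartition (m * m) lam).toMatIdx := by
  rw [valuativeFlip_iff]
  constructor
  · intro h c
    obtain ⟨n₀, hn₀⟩ := h c
    exact ⟨n₀, fun n hn m _ hnm hm => hn₀ n hn m hnm.le hm⟩
  · intro h c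
    obtain ⟨n₀, hn₀⟩ := h c
    refine ⟨max n₀ 3, fun n hn m _ hnm hm => ?_⟩
    have hn₀' : n₀ ≤ n := le_of_max_le_left hn
    have hn3 : 3 ≤ n := le_of_max_le_right hn
    rcases hnm.eq_or_lt with rfl | hlt'
    · obtain ⟨δ, lam, hcard, hlt⟩ := bottomCensusFlip n hn3
      refine ⟨⊥, 0, δ, lam, ?_, hcard, ?_⟩
      · intro u hu
        rw [Submodule.mem_bot] at hu
        subst hu
        have h0 : (Matrix.of fun a b : Fin n => (0 : MatIdx n → ℂ) (toLex (a, b))) = 0 := by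
          ext a b
          simp
        rw [h0, Matrix.rank_zero]
      · exact lt_of_le_of_lt (Submodule.finrank_mono (truncT_le_explT n (n * δ) ⊥ _ (δ * (n - 0)))) hlt
    · exact hn₀ n hn₀' m hlt' hm

end

end Summit.ValiantsHypothesis.ValiantsHypothesis.Cruxes.ValuativeFlip.SkewRestrictionRank
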